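import Literature.NumberTheory.DiophantineGeometry.AVKernelHopf
import HarnessLib

/-!
# The Hopf algebra `Γ(G, 𝒪_G)` of an affine group scheme over a RING, and its points as the convolution group

Layer `Literature/AlgebraicGeometry/GroupSchemes`, namespace `Literature.AlgebraicGeometry.GroupSchemes.AffineGroupScheme`.  One `def`
carrier `Alg G := Γ(G, 𝒪_G)` with its structures (instances ONLY on this file's own carrier, the ★ pattern of
`Motives/AbelianVarietyFiniteSubgroupSubscheme.Alg` ∕ `AVKernelHopf.KerAlg`), the points dictionary and the functorial group law; no
instance on anything else, no notation, no named fact, no `sorry`.  Cell `hodgecm-mathlib` (D-0151), programme P6 «MOD», HEART organ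
**(GAP-1)** of F0P6b-plan (g0)'s CENSUS-P6b-HEART-b1b3b4 v0 §0∕§3 («the GROUP half of the bridge over a RING … the engine behind b1a∕b1c∕b4»);
B-p04 (g36).  Count-neutral Mathlib-side capital: HC_CM is proved only modulo the 7 printed citations until rung 0 closes; nothing here
bears on it.

THE PRINT ([GortzWedhorn2023] (27.1.1), §(27.2) (27.2.1), Def. 27.6, pp. 606–607; W. C. Waterhouse, *Introduction to Affine Group Schemes*, §§1.3–1.4): an affine group scheme
`G = Spec H` over a ring `R` «is the same as» a commutative Hopf `R`-algebra `H`: the group structures on the points `G(R′) = Hom_R(H, R′)`,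
natural in the commutative `R`-algebra `R′`, give `Δ = p₁·p₂`, `ε =` the unit point, `S = id⁻¹`, and the product of points is the
convolution product.  The tree has the pure-algebra half ★ `CorepGroupLaw K H ⟹ HopfAlgebra K H` (any commutative ring `K`;
`Literature.NumberTheory.DiophantineGeometry.CorepGroupLaw`) and runs the dictionary over a FIELD for kernels of isogenies (★ `AVKernelHopf`)
and for finite subgroup schemes of abelian varieties (★ `FiniteSubgroupSubscheme.groupLaw`).  THIS FILE runs it over an arbitrary
commutative RING `R` for an arbitrary AFFINE group object `G` of `SchemeOver R = Over (Spec R)` (Mathlib `GrpObj`; e.g. a finite flat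
group scheme — `isAffine_left_of_isAffineHom`), which is what P6's HEART meets (`𝒜_x[𝔴]` over the henselian valuation ring `V`):

* §1 `Alg G := Γ(G.left, ⊤)` as a commutative `R`-algebra through ★ `algebraMapΓ G.hom`; finite over `R` when `G → Spec R` is finite;
* §2 **`ptEquiv G R′ : (specOver R R′ ⟶ G) ≃ (Alg G →ₐ[R] R′)`** (★ `specHomEquivUnderHom`, ★ `underHomEquivAlgHom`), natural in `R′`
  (`ptEquiv_comap`, along ★ `AlgPoints.specOverMapOfAlgHom`);
* §3 **`groupLaw G : CorepGroupLaw R (Alg G)`** — Mathlib's `Hom.group` on `specOver R R′ ⟶ G` transported along `ptEquiv` — hence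
  **`HopfAlgebra R (Alg G)`** (★ `CorepGroupLaw.toHopfAlgebra`), cocommutative when `G` is commutative; `groupLaw_mul_apply ∕ _one ∕ _inv_apply`
  (the law IS the product ∕ unit ∕ inverse of points; in particular the counit is the algebra map of the unit point `1 = toUnit ≫ η`);
* §4 **`ptMulEquiv G R′ : (specOver R R′ ⟶ G) ≃* WithConv (Alg G →ₐ[R] R′)`** — the points of `G` with their group law ARE Mathlib's
  convolution monoid of algebra maps (★ `CorepGroupLaw.toConv_mul`).

NOT HERE: the base-change clause `R′ ⊗_R Γ(G) ≅ Γ(G_{R′})` as Hopf algebras (sequel), Cartier duality, Deligne's theorem over a ring.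

## References
* [GortzWedhorn2023] U. Görtz, T. Wedhorn, *Algebraic Geometry II* (2023), (27.1.1), §(27.2) (27.2.1) and Def. 27.6 (pp. 606–607).
* W. C. Waterhouse, *Introduction to Affine Group Schemes* (1979), §§1.3–1.4 (not a bib key; cited after ★ `CorepGroupLaw`).
-/

set_option autoImplicit false

universe u

open CategoryTheory CategoryTheory.Limits AlgebraicGeometry MonoidalCategory CartesianMonoidalCategory TensorProduct WithConv

noncomputable section

namespace Literature.AlgebraicGeometry.GroupSchemes

namespace AffineGroupScheme

open scoped MonObj

open Literature.AlgebraicGeometry.Motives Literature.NumberTheory.DiophantineGeometry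

variable {R : Type u} [CommRing R] (G : SchemeOver R)

/-! ## §1 The affine algebra `Γ(G, 𝒪_G)` -/

/-- An `R`-scheme affine over `Spec R` (e.g. finite, or finite flat) is an affine scheme (Mathlib `isAffine_of_isAffineHom`).
[cite: GortzWedhorn2023, §(27.2) (p. 606)] -/
theorem isAffine_left_of_isAffineHom [IsAffineHom G.hom] : IsAffine G.left :=
  isAffine_of_isAffineHom G.hom

/-- The affine algebra `Γ(G, 𝒪_G)` of the `R`-scheme `G` (a `def` carrier, so that the `R`-algebra and Hopf structures below are attached
to it only). [cite: GortzWedhorn2023, §(27.2) (p. 606)] -/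
def Alg : Type u := Γ(G.left, ⊤)

/-- The ring structure of `Γ(G, 𝒪_G)`. [cite: GortzWedhorn2023, §(27.2) (p. 606)] -/
instance Alg.instCommRing : CommRing (Alg G) := inferInstanceAs (CommRing Γ(G.left, ⊤))

/-- `Γ(G, 𝒪_G)` is an `R`-algebra through `R ≅ Γ(Spec R) → Γ(G)` (★ `algebraMapΓ`). [cite: GortzWedhorn2023, §(27.2) (p. 606)] -/
instance Alg.instAlgebra : Algebra R (Alg G) := (algebraMapΓ G.hom).hom.toAlgebra

/-- Unfolding the `R`-algebra structure of `Γ(G, 𝒪_G)`. [cite: GortzWedhorn2023, §(27.2) (p. 606)] -/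
theorem Alg.algebraMap_eq : algebraMap R (Alg G) = (algebraMapΓ G.hom).hom := rfl

/-- `Γ(G, 𝒪_G)` is a finite `R`-algebra when `G → Spec R` is finite. [cite: GortzWedhorn2023, §(27.2) (p. 606)] -/
theorem Alg.moduleFinite [IsFinite G.hom] : Module.Finite R (Alg G) := by
  have h1 : G.hom.appTop.hom.Finite := G.hom.finite_appTop
  have h2 : (Scheme.ΓSpecIso (.of R)).inv.hom.Finite :=
    RingHom.Finite.of_surjective _ fun y ↦ ⟨(Scheme.ΓSpecIso (.of R)).hom.hom y, by
      rw [← CommRingCat.comp_apply, Iso.hom_inv_id, CommRingCat.id_apply]⟩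
  exact h1.comp h2

/-! ## §2 Points `Spec R′ → G` over `R` are the `R`-algebra maps `Γ(G, 𝒪_G) → R′` -/

section Points

variable [IsAffine G.left] {R' R'' : Type u} [CommRing R'] [Algebra R R'] [CommRing R''] [Algebra R R'']

variable (R') in
/-- **`G(Spec R′) ≃ Hom_{R-alg}(Γ(G, 𝒪_G), R′)`** for an affine `R`-scheme `G` and a commutative `R`-algebra `R′`: an `R`-morphism
`Spec R′ → G` is `Spec` of a ring map `Γ(G) → R′` under `R` (`G ≅ Spec Γ(G)`; ★ `specHomEquivUnderHom`, ★ `underHomEquivAlgHom`).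
[cite: GortzWedhorn2023, §(27.2) (p. 606)] -/
def ptEquiv : (specOver R R' ⟶ G) ≃ (Alg G →ₐ[R] R') :=
  (show (specOver R R' ⟶ G) ≃ {x : Spec (.of R') ⟶ G.left // x ≫ G.hom = Spec.map (CommRingCat.ofHom (algebraMap R R'))} from
    { toFun := fun u ↦ ⟨u.left, Over.w u⟩
      invFun := fun x ↦ Over.homMk x.1 x.2
      left_inv := fun _ ↦ rfl
      right_inv := fun _ ↦ rfl }).trans <|
    (specHomEquivUnderHom G.hom R').trans (underHomEquivAlgHom (algebraMapΓ G.hom) R')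

/-- The ring homomorphism underlying `ptEquiv u` is `Γ` of `Spec R′ → G ≅ Spec Γ(G, 𝒪_G)` (as `Spec.preimage`).
[cite: GortzWedhorn2023, §(27.2) (p. 606)] -/
theorem ofHom_ptEquiv (u : specOver R R' ⟶ G) :
    CommRingCat.ofHom (ptEquiv G R' u).toRingHom = Spec.preimage (u.left ≫ G.left.isoSpec.hom) :=
  rfl

/-- **Naturality of `ptEquiv`** in the `R`-algebra `R′`: precomposing a point with `Spec ψ` composes its algebra map with `ψ`.
[cite: GortzWedhorn2023, §(27.2) (p. 606)] -/
theorem ptEquiv_comap (ψ : R' →ₐ[R] R'') (u : specOver R R' ⟶ G) :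
    ptEquiv G R'' (AlgPoints.specOverMapOfAlgHom ψ ≫ u) = ψ.comp (ptEquiv G R' u) := by
  apply AlgHom.coe_ringHom_injective
  change (Spec.preimage ((AlgPoints.specOverMapOfAlgHom ψ ≫ u).left ≫ G.left.isoSpec.hom)).hom =
    (Spec.preimage (u.left ≫ G.left.isoSpec.hom) ≫ CommRingCat.ofHom ψ.toRingHom).hom
  congr 1
  apply Spec.map_injective
  simp only [Spec.map_comp, Spec.map_preimage, Over.comp_left, AlgPoints.specOverMapOfAlgHom_left]
  exact Category.assoc _ _ _

end Points

/-! ## §3 The functorial group law and the Hopf algebra -/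

section Law

variable [GrpObj G] [IsAffine G.left] {R' : Type u} [CommRing R'] [Algebra R R']

/-- **The functorial group law on `Hom_{R-alg}(Γ(G, 𝒪_G), R′)`**: Mathlib's group `G(Spec R′) = (specOver R R′ ⟶ G)` (`Hom.group` of the
group object `G`) transported along `ptEquiv`, natural in `R′` by `ptEquiv_comap`. [cite: GortzWedhorn2023, §(27.2) (27.2.1) (pp. 606–607)] -/
def groupLaw : CorepGroupLaw R (Alg G) where
  mul := fun R' _ _ φ χ ↦ ptEquiv G R' ((ptEquiv G R').symm φ * (ptEquiv G R').symm χ)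
  one := fun R' _ _ ↦ ptEquiv G R' 1
  inv := fun R' _ _ φ ↦ ptEquiv G R' ((ptEquiv G R').symm φ)⁻¹
  mul_assoc x y z := by simp only [Equiv.symm_apply_apply, mul_assoc]
  one_mul x := by simp only [Equiv.symm_apply_apply, one_mul, Equiv.apply_symm_apply]
  inv_mul x := by simp only [Equiv.symm_apply_apply, inv_mul_cancel]
  comp_mul ψ x y := by
    obtain ⟨a, rfl⟩ := (ptEquiv G _).surjective x
    obtain ⟨b, rfl⟩ := (ptEquiv G _).surjective y
    simp only [Equiv.symm_apply_apply, ← ptEquiv_comap, MonObj.comp_mul]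
  comp_one ψ := by rw [← ptEquiv_comap, MonObj.comp_one]

/-- The product of the group law is the product of points of `G`. [cite: GortzWedhorn2023, §(27.2) (27.2.1) (pp. 606–607)] -/
theorem groupLaw_mul_apply (x y : specOver R R' ⟶ G) :
    (groupLaw G).mul (ptEquiv G R' x) (ptEquiv G R' y) = ptEquiv G R' (x * y) := by
  change ptEquiv G R' ((ptEquiv G R').symm (ptEquiv G R' x) * (ptEquiv G R').symm (ptEquiv G R' y)) = _
  rw [Equiv.symm_apply_apply, Equiv.symm_apply_apply]

/-- The unit of the group law is the unit point `1 = (Spec R′ → Spec R) ≫ η` of `G`. [cite: GortzWedhorn2023, §(27.2) (27.2.1) (pp. 606–607)] -/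
theorem groupLaw_one : (groupLaw G).one R' = ptEquiv G R' 1 := rfl

/-- The inverse of the group law is the inverse of points of `G`. [cite: GortzWedhorn2023, §(27.2) (27.2.1) (pp. 606–607)] -/
theorem groupLaw_inv_apply (x : specOver R R' ⟶ G) : (groupLaw G).inv (ptEquiv G R' x) = ptEquiv G R' x⁻¹ := by
  change ptEquiv G R' ((ptEquiv G R').symm (ptEquiv G R' x))⁻¹ = _
  rw [Equiv.symm_apply_apply]

/-- **The Hopf algebra of the affine group scheme**: `Γ(G, 𝒪_G)` is a commutative Hopf `R`-algebra (★ `CorepGroupLaw.toHopfAlgebra`),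
with comultiplication `p₁·p₂`, counit the unit point and antipode `id⁻¹`. [cite: GortzWedhorn2023, §(27.2) (27.2.1) and Definition 27.6 (pp. 606–607)] -/
instance Alg.instHopfAlgebra : HopfAlgebra R (Alg G) := (groupLaw G).toHopfAlgebra

/-- It is cocommutative when `G` is a commutative group scheme. [cite: GortzWedhorn2023, §(27.2) (p. 607)] -/
theorem Alg.isCocomm [IsCommMonObj G] : Coalgebra.IsCocomm R (Alg G) :=
  (groupLaw G).isCocomm fun x y ↦ by
    obtain ⟨a, rfl⟩ := (ptEquiv G _).surjective x
    obtain ⟨b, rfl⟩ := (ptEquiv G _).surjective y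
    rw [groupLaw_mul_apply, groupLaw_mul_apply, mul_comm]

/-! ## §4 Points multiply by convolution -/

variable (R') in
/-- **The points of `G` ARE the convolution monoid of algebra maps**: the group `G(Spec R′)` is isomorphic, by `ptEquiv`, to Mathlib's
convolution monoid `WithConv (Γ(G, 𝒪_G) →ₐ[R] R′)` of the Hopf algebra `Γ(G, 𝒪_G)` (★ `CorepGroupLaw.toConv_mul`).
[cite: GortzWedhorn2023, §(27.2) (27.2.1) (pp. 606–607)] -/
def ptMulEquiv : (specOver R R' ⟶ G) ≃* WithConv (Alg G →ₐ[R] R') where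
  toFun u := toConv (ptEquiv G R' u)
  invFun φ := (ptEquiv G R').symm (ofConv φ)
  left_inv u := by
    change (ptEquiv G R').symm (ofConv (toConv (ptEquiv G R' u))) = u
    rw [ofConv_toConv, Equiv.symm_apply_apply]
  right_inv φ := by
    change toConv (ptEquiv G R' ((ptEquiv G R').symm (ofConv φ))) = φ
    rw [Equiv.apply_symm_apply, toConv_ofConv]
  map_mul' u v := by
    rw [← groupLaw_mul_apply]
    exact (groupLaw G).toConv_mul _ _

/-- `ptMulEquiv u = toConv (ptEquiv u)`. [cite: GortzWedhorn2023, §(27.2) (p. 606)] -/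
theorem ptMulEquiv_apply (u : specOver R R' ⟶ G) : ptMulEquiv G R' u = toConv (ptEquiv G R' u) := rfl

/-- The unit point goes to the unit of the convolution monoid. [cite: GortzWedhorn2023, §(27.2) (27.2.1) (pp. 606–607)] -/
theorem ptMulEquiv_one : ptMulEquiv G R' 1 = 1 := by
  rw [ptMulEquiv_apply, ← groupLaw_one]
  exact (groupLaw G).toConv_one

/-- The inverse of a point is a two-sided convolution inverse: `u⁻¹ ⋆ u = 1`. [cite: GortzWedhorn2023, §(27.2) (27.2.1) (pp. 606–607)] -/
theorem ptMulEquiv_inv_mul (u : specOver R R' ⟶ G) : ptMulEquiv G R' u⁻¹ * ptMulEquiv G R' u = 1 := by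
  rw [← map_mul, inv_mul_cancel, ptMulEquiv_one]

end Law

end AffineGroupScheme

end Literature.AlgebraicGeometry.GroupSchemes

end
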